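import Summits.Ventures.Crystal3D.Bulk.GapKiteMap
import Summits.Ventures.Crystal3D.Bulk.GapKiteHoleCorner
import HarnessLib

/-!
# The corners of a P-kite lie on ONE explicit curve: `(u_a, u_p, u_b)(x)`, `x = ⟪u_b, p̂⟫`,
# `x♭(D) ≤ x ≤ D/2` — and the values of that curve at its two ends

HONEST FRAMING. Part of the venture `Summits/Ventures/Crystal3D` (cell `pub-crystal3d`, phase 2;
seat p2, PROMOTION-AUDIT prep, memo r1.1 A6 (b1): the B-lineage hole-quadrilateral tables `PZ4_I`
/ `PZ4_W1`). Kernel theorems about an ADMISSIBLE fourteen-ball configuration `c` (`IsGapConfig c`;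
no extremality, NO convexity / face hypothesis) and pure real identities; nothing here asserts
anything about GAP(1.26); no census number, head, class or grade word moves.

A P-kite `(p, a, b, e)`: shell balls `a ≠ e` touching the intruder `p` (ball `13`), a shell ball
`b` touching `a` and `e` (sides `ρ, 60°, 60°, ρ`; polylib's `PZ4` polygon `A₂ = p, A₁ = a,
A₃ = e, A₄ = b`). With `D = intruderDist c` and the ONE parameter `x = ⟪u_b, p̂⟫ = cos |pb|`:

* §1 **`IsGapConfig.kite_on_curve`** — for every admissible configuration with `D² ≤ 2`:
  `x ≤ D/2` (pair row), `3x² − 2Dx + D² − 2 ≤ 0` (`⟪u_a, u_e⟫ ≤ 1/2` through the closure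
  relation `IsGapConfig.kite_diag_relation`), and the three corners ARE
  `u_a = corner c a 13 b = arccos ((4x − D)/(√3 √(4 − D²)))` (`IsGapConfig.cos_corner_shell_hole`),
  `u_p = corner c 13 a e = arccos (((4 + D²)x² − 4Dx + D² − 2)/((4 − D²)(1 − x²)))`
  (`IsGapConfig.cos_hole_corner`), `u_b = corner c b a e = arccos ((5x² − 4Dx + 2D² − 3)/(3(1 − x²)))`
  (`IsGapConfig.cos_corner_rhombus`); the fourth corner is `corner c e 13 b = u_a`
  (`IsGapConfig.kite_corner_eq`, `Bulk/GapKite.lean`).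
* §2 the curve at its two ends (pure real identities): at `x = D/2` (`|pb| = ρ`)
  `(u_a, u_p, u_b) = (A_x, 2A_p, 2A_x)` (`kiteUa_at_half`, `kiteUp_at_half`, `kiteUb_at_half`);
  at the flat end `x♭(D)`, the smaller root of `3x² − 2Dx + D² − 2` (`|ae| = 60°`),
  `(u_a, u_p, u_b) = (A_x + α₀, A_p, α₀)` (`kiteUa_at_flat`, `kiteUp_at_flat`, `kiteUb_at_flat`),
  `A_x = arccos (D/(√3 √(4 − D²)))`, `A_p = arccos ((2 − D²)/(4 − D²))`, `α₀ = arccos (1/3)`.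

With the calculus of the curve (`Bulk/GapKiteCalculus.lean`: a row `α u_a + c₂ u_p + c₄ u_b` is
monotone in `x` wherever one quadratic keeps a sign) these give the kite rows of the tables; that
assembly is a separate file. [folklore spherical trigonometry]
-/

noncomputable section

open scoped BigOperators InnerProductSpace
open Finset Real

namespace Summit.Ventures.Crystal3D

/-! ## §1 The corners of a P-kite as functions of `x = ⟪u_b, p̂⟫` -/

section Config

open Literature.Geometry.DiscreteGeometry InnerProductGeometry

variable {c : Fin 14 → EuclideanSpace ℝ (Fin 3)}

/-- **The corners of a P-kite lie on the explicit curve.** For an admissible configuration with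
`D² ≤ 2`, shell balls `a ≠ e` touching the intruder and a shell ball `b` touching `a` and `e`, with
`x = ⟪u_b, p̂⟫`: `x ≤ D/2`, `3x² − 2Dx + D² − 2 ≤ 0`, and
`corner c a 13 b = arccos ((4x − D)/(√3 √(4 − D²)))`,
`corner c 13 a e = arccos (((4 + D²)x² − 4Dx + D² − 2)/((4 − D²)(1 − x²)))`,
`corner c b a e = arccos ((5x² − 4Dx + 2D² − 3)/(3(1 − x²)))`. [folklore] -/
theorem IsGapConfig.kite_on_curve (hc : IsGapConfig c) (hD2 : intruderDist c ^ 2 ≤ 2)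
    {a e b : Fin 14} (ha0 : a ≠ 0) (ha13 : a ≠ 13) (he0 : e ≠ 0) (he13 : e ≠ 13) (hb0 : b ≠ 0)
    (hb13 : b ≠ 13) (hae : a ≠ e) (ha : dist (c a) (c 13) = 1) (he : dist (c e) (c 13) = 1)
    (hba : dist (c b) (c a) = 1) (hbe : dist (c b) (c e) = 1) :
    ⟪gapDir c b, gapDir c 13⟫_ℝ ≤ intruderDist c / 2 ∧
    3 * ⟪gapDir c b, gapDir c 13⟫_ℝ ^ 2 - 2 * intruderDist c * ⟪gapDir c b, gapDir c 13⟫_ℝ +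
        intruderDist c ^ 2 - 2 ≤ 0 ∧
    corner c a 13 b = Real.arccos ((4 * ⟪gapDir c b, gapDir c 13⟫_ℝ - intruderDist c) /
        (√3 * √(4 - intruderDist c ^ 2))) ∧
    corner c 13 a e = Real.arccos (((4 + intruderDist c ^ 2) * ⟪gapDir c b, gapDir c 13⟫_ℝ ^ 2 -
        4 * intruderDist c * ⟪gapDir c b, gapDir c 13⟫_ℝ + intruderDist c ^ 2 - 2) /
          ((4 - intruderDist c ^ 2) * (1 - ⟪gapDir c b, gapDir c 13⟫_ℝ ^ 2))) ∧
    corner c b a e = Real.arccos ((5 * ⟪gapDir c b, gapDir c 13⟫_ℝ ^ 2 -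
        4 * intruderDist c * ⟪gapDir c b, gapDir c 13⟫_ℝ + 2 * intruderDist c ^ 2 - 3) /
          (3 * (1 - ⟪gapDir c b, gapDir c 13⟫_ℝ ^ 2))) := by
  set D := intruderDist c with hDdef
  set x := ⟪gapDir c b, gapDir c 13⟫_ℝ with hxdef
  have hD1 : 1 ≤ D := hc.one_le_intruderDist
  have hD : D < 2 := by nlinarith
  have h13 : (13 : Fin 14) ≠ 0 := by decide
  -- pair row `x ≤ D/2`
  have hx : x ≤ D / 2 := by
    have h := hc.inner_gapDir_le hb0 h13 hb13
    rwa [tightLevel_of_right] at h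
  -- `G = ⟪u_a, u_e⟫ ≤ 1/2` and the closure relation `2(1 − x²)(G + 1/2) = (D − x)²`
  have hG : ⟪gapDir c a, gapDir c e⟫_ℝ ≤ 1 / 2 := by
    have h := hc.inner_gapDir_le ha0 he0 hae
    rwa [tightLevel_of_ne ha13 he13] at h
  have hrel := hc.kite_diag_relation hD ha0 ha13 hb0 hb13 he0 he13 hae
    (by rw [dist_comm]; exact hba) hbe ha he
  rw [← hxdef, ← hDdef] at hrel
  have hx1 : x ^ 2 ≤ 1 := by
    have h := abs_real_inner_le_norm (gapDir c b) (gapDir c 13)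
    rw [hc.norm_gapDir hb0, hc.norm_gapDir h13, mul_one, ← hxdef] at h
    have h' := abs_le.1 h
    nlinarith [h'.1, h'.2]
  have hP : 3 * x ^ 2 - 2 * D * x + D ^ 2 - 2 ≤ 0 := by
    have h1 : 0 ≤ 1 - x ^ 2 := by linarith
    nlinarith [mul_le_mul_of_nonneg_left hG h1]
  have hxsq : x ^ 2 < 1 := by
    have h0 : 0 < (D - x) ^ 2 := pow_pos (by linarith) 2
    nlinarith
  have hx1' : 1 - x ^ 2 ≠ 0 := by linarith
  have hGx : ⟪gapDir c a, gapDir c e⟫_ℝ = (D - x) ^ 2 / (2 * (1 - x ^ 2)) - 1 / 2 := by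
    field_simp
    linarith
  refine ⟨hx, hP, ?_, ?_, ?_⟩
  · -- `u_a`
    have h0 : 0 ≤ corner c a 13 b := InnerProductGeometry.angle_nonneg _ _
    have hπ : corner c a 13 b ≤ π := InnerProductGeometry.angle_le_pi _ _
    rw [← Real.arccos_cos h0 hπ, hc.cos_corner_shell_hole ha0 ha13 hb0 hb13 ha
      (by rw [dist_comm]; exact hba)]
    congr 1
    have e1 : (1 : ℝ) - D ^ 2 / 4 = 1 - (D / 2) ^ 2 := by ring
    rw [← hxdef, ← hDdef, e1, sqrt_one_sub_half_mul_sq]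
    have hs3 : √3 ≠ 0 := (Real.sqrt_pos.2 (by norm_num)).ne'
    have hs4 : √(4 - D ^ 2) ≠ 0 := (Real.sqrt_pos.2 (by nlinarith)).ne'
    field_simp
    ring
  · -- `u_p`
    have h0 : 0 ≤ corner c 13 a e := InnerProductGeometry.angle_nonneg _ _
    have hπ : corner c 13 a e ≤ π := InnerProductGeometry.angle_le_pi _ _
    rw [← Real.arccos_cos h0 hπ, hc.cos_hole_corner hD ha0 he0 ha he, hGx]
    congr 1
    rw [← hDdef]
    have h4 : (4 : ℝ) - D ^ 2 ≠ 0 := by nlinarith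
    have h4' : (1 : ℝ) - D ^ 2 / 4 ≠ 0 := by nlinarith
    field_simp
    ring
  · -- `u_b`
    have h0 : 0 ≤ corner c b a e := InnerProductGeometry.angle_nonneg _ _
    have hπ : corner c b a e ≤ π := InnerProductGeometry.angle_le_pi _ _
    rw [← Real.arccos_cos h0 hπ, hc.cos_corner_rhombus hb0 hb13 ha0 ha13 he0 he13 hba hbe, hGx]
    congr 1
    field_simp
    ring

end Config

/-! ## §2 The curve at its two ends -/

/-- At `x = D/2` (`|pb| = ρ`): `u_a = A_x(D)`. [folklore] -/
theorem kiteUa_at_half (D : ℝ) :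
    Real.arccos ((4 * (D / 2) - D) / (√3 * √(4 - D ^ 2))) =
      Real.arccos (D / (√3 * √(4 - D ^ 2))) := by
  congr 1; ring

/-- At `x = D/2`: `u_p = 2 A_p(D)` (`D² ≤ 2`; double angle). [folklore] -/
theorem kiteUp_at_half {D : ℝ} (hD2 : D ^ 2 ≤ 2) :
    Real.arccos (((4 + D ^ 2) * (D / 2) ^ 2 - 4 * D * (D / 2) + D ^ 2 - 2) /
        ((4 - D ^ 2) * (1 - (D / 2) ^ 2))) =
      2 * Real.arccos ((2 - D ^ 2) / (4 - D ^ 2)) := by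
  have h4 : 0 < 4 - D ^ 2 := by nlinarith
  set z := (2 - D ^ 2) / (4 - D ^ 2) with hz
  have hz0 : 0 ≤ z := div_nonneg (by linarith) h4.le
  have hz1 : z ≤ 1 := by rw [hz, div_le_one h4]; linarith
  rw [← arccos_two_mul_sq_sub_one hz0 hz1]
  congr 1
  have h4' : (4 : ℝ) - D ^ 2 ≠ 0 := h4.ne'
  have hden : (4 - D ^ 2) * (1 - (D / 2) ^ 2) ≠ 0 := mul_ne_zero h4' (by nlinarith)
  rw [div_eq_iff hden, hz]
  field_simp
  ring

/-- At `x = D/2`: `u_b = 2 A_x(D)` (`0 ≤ D`, `D² ≤ 3`; double angle). [folklore] -/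
theorem kiteUb_at_half {D : ℝ} (hD0 : 0 ≤ D) (hD3 : D ^ 2 ≤ 3) :
    Real.arccos ((5 * (D / 2) ^ 2 - 4 * D * (D / 2) + 2 * D ^ 2 - 3) / (3 * (1 - (D / 2) ^ 2))) =
      2 * Real.arccos (D / (√3 * √(4 - D ^ 2))) := by
  have h4 : 0 < 4 - D ^ 2 := by linarith
  have hs3 : 0 < √3 := Real.sqrt_pos.2 (by norm_num)
  have hs4 : 0 < √(4 - D ^ 2) := Real.sqrt_pos.2 h4
  set z := D / (√3 * √(4 - D ^ 2)) with hz
  have hz0 : 0 ≤ z := div_nonneg hD0 (mul_pos hs3 hs4).le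
  have hz2 : z ^ 2 = D ^ 2 / (3 * (4 - D ^ 2)) := by
    rw [hz, div_pow, mul_pow, Real.sq_sqrt (by norm_num : (0:ℝ) ≤ 3), Real.sq_sqrt h4.le]
  have hz1 : z ≤ 1 := by
    have h : z ^ 2 ≤ 1 := by rw [hz2, div_le_one (by positivity)]; linarith
    nlinarith
  rw [← arccos_two_mul_sq_sub_one hz0 hz1, hz2]
  congr 1
  have h4' : (4 : ℝ) - D ^ 2 ≠ 0 := h4.ne'
  have hden : (3 : ℝ) * (1 - (D / 2) ^ 2) ≠ 0 := mul_ne_zero three_ne_zero (by nlinarith)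
  rw [div_eq_iff hden]
  field_simp
  ring

/-- At a root of `3x² − 2Dx + D² − 2` (the flat end, `|ae| = 60°`): `u_p = A_p(D)`
(`((4 + D²)x² − 4Dx + D² − 2) − (2 − D²)(1 − x²) = 2(3x² − 2Dx + D² − 2)`). [folklore] -/
theorem kiteUp_at_flat {D x : ℝ} (hD4 : D ^ 2 < 4) (hx : x ^ 2 < 1)
    (hP : 3 * x ^ 2 - 2 * D * x + D ^ 2 - 2 = 0) :
    Real.arccos (((4 + D ^ 2) * x ^ 2 - 4 * D * x + D ^ 2 - 2) / ((4 - D ^ 2) * (1 - x ^ 2))) =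
      Real.arccos ((2 - D ^ 2) / (4 - D ^ 2)) := by
  congr 1
  have h1 : 1 - x ^ 2 ≠ 0 := by linarith
  have h4 : 4 - D ^ 2 ≠ 0 := by linarith
  rw [div_eq_div_iff (mul_ne_zero h4 h1) h4]
  linear_combination (2 * (4 - D ^ 2)) * hP

/-- At a root of `3x² − 2Dx + D² − 2`: `u_b = α₀ = arccos (1/3)`
(`(5x² − 4Dx + 2D² − 3) − (1 − x²) = 2(3x² − 2Dx + D² − 2)`). [folklore] -/
theorem kiteUb_at_flat {D x : ℝ} (hx : x ^ 2 < 1) (hP : 3 * x ^ 2 - 2 * D * x + D ^ 2 - 2 = 0) :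
    Real.arccos ((5 * x ^ 2 - 4 * D * x + 2 * D ^ 2 - 3) / (3 * (1 - x ^ 2))) =
      Real.arccos (1 / 3) := by
  congr 1
  have h1 : 1 - x ^ 2 ≠ 0 := by linarith
  rw [div_eq_div_iff (mul_ne_zero three_ne_zero h1) three_ne_zero]
  linear_combination 6 * hP

/-- At the SMALLER root of `3x² − 2Dx + D² − 2` (`3x ≤ D`, i.e. `x = x♭(D) = (D − √(6 − 2D²))/3`):
`u_a = A_x(D) + α₀` (`0 ≤ D`, `D² < 3`). Proof: `cos (A_x + α₀) = cos A_x /3 − sin A_x · 2√2/3 =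
(D − 4√(6 − 2D²))/(3 √3 √(4 − D²)) = (4x − D)/(√3 √(4 − D²))`, and `0 ≤ A_x + α₀ ≤ π`. [folklore] -/
theorem kiteUa_at_flat {D x : ℝ} (hD0 : 0 ≤ D) (hD3 : D ^ 2 < 3) (h3x : 3 * x ≤ D)
    (hP : 3 * x ^ 2 - 2 * D * x + D ^ 2 - 2 = 0) :
    Real.arccos ((4 * x - D) / (√3 * √(4 - D ^ 2))) =
      Real.arccos (D / (√3 * √(4 - D ^ 2))) + Real.arccos (1 / 3) := by
  have h4 : 0 < 4 - D ^ 2 := by linarith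
  have hs3 : 0 < √3 := Real.sqrt_pos.2 (by norm_num)
  have hs4 : 0 < √(4 - D ^ 2) := Real.sqrt_pos.2 h4
  set s := √3 * √(4 - D ^ 2) with hs
  have hs0 : 0 < s := mul_pos hs3 hs4
  have hs2 : s ^ 2 = 3 * (4 - D ^ 2) := by
    rw [hs, mul_pow, Real.sq_sqrt (by norm_num : (0:ℝ) ≤ 3), Real.sq_sqrt h4.le]
  have h62 : 0 ≤ 6 - 2 * D ^ 2 := by linarith
  -- the smaller root: `D − 3x = √(6 − 2D²)`
  have hroot : D - 3 * x = √(6 - 2 * D ^ 2) := by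
    have h1 : (D - 3 * x) ^ 2 = 6 - 2 * D ^ 2 := by linear_combination 3 * hP
    rw [← h1, Real.sqrt_sq (by linarith)]
  have hDs0 : 0 ≤ D / s := div_nonneg hD0 hs0.le
  have hDs1 : D / s ≤ 1 := by
    rw [div_le_one hs0]
    nlinarith [hs2]
  set A := Real.arccos (D / s) with hA
  set T := Real.arccos (1 / 3 : ℝ) with hT
  have hA0 : 0 ≤ A := Real.arccos_nonneg _
  have hT0 : 0 ≤ T := Real.arccos_nonneg _
  have hAπ : A ≤ π / 2 := Real.arccos_le_pi_div_two.2 hDs0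
  have hTπ : T ≤ π / 2 := Real.arccos_le_pi_div_two.2 (by norm_num)
  have hcos : Real.cos (A + T) = (4 * x - D) / s := by
    rw [Real.cos_add, hA, hT, Real.cos_arccos (by linarith) hDs1,
      Real.cos_arccos (by norm_num) (by norm_num), Real.sin_arccos, Real.sin_arccos]
    have hprod : √(1 - (D / s) ^ 2) * √(1 - (1 / 3 : ℝ) ^ 2) = 4 * √(6 - 2 * D ^ 2) / (3 * s) := by
      have ha : 0 ≤ 1 - (D / s) ^ 2 := by nlinarith
      rw [← Real.sqrt_mul ha]
      have hDs2 : (D / s) ^ 2 = D ^ 2 / (3 * (4 - D ^ 2)) := by rw [div_pow, hs2]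
      have e2 : (4 * √(6 - 2 * D ^ 2) / (3 * s)) ^ 2 = 16 * (6 - 2 * D ^ 2) / (27 * (4 - D ^ 2)) := by
        rw [div_pow, mul_pow, mul_pow, Real.sq_sqrt h62, hs2]; ring
      have e : (1 - (D / s) ^ 2) * (1 - (1 / 3 : ℝ) ^ 2) = (4 * √(6 - 2 * D ^ 2) / (3 * s)) ^ 2 := by
        rw [e2, hDs2]
        field_simp
        ring
      rw [e, Real.sqrt_sq (by positivity)]
    rw [hprod, ← hroot]
    field_simp
    ring
  rw [← hcos, Real.arccos_cos (by linarith) (by linarith)]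

end Summit.Ventures.Crystal3D

end
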